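import Literature.MathematicalPhysics.QuantumFieldTheory.MullerSchiemann1987.MS87HeatKernelGroup
import HarnessLib

/-!
# Müller–Schiemann, *Continuum limit of a hierarchical SU(2) lattice gauge theory in 4 dimensions*
# (CMP 110, 1987), (2.10)–(2.12) p.264 and THEOREM 2 PART 1) p.280 («1) restates (A₁)», p.281), MODEL-FREE:
# for ANY continued Gibbs factor `g̃` with the symmetries (2.8), (2.9), the angular function `h(z) := g̃(e₀, z)` is
# `2π`-periodic and even on `ℂ`, entire when `g̃(e₀, ·)` is, and real positive on `ℝ` when `g = g̃(·, 0)` is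
# — PROVED (theorems only; no definition, no named fact)

statement-level skeleton of published theorems with citation tags; proofs where landed; nothing here is a claim about the Yang–Mills mass gap

[MullerSchiemann1987] V. F. Müller, J. Schiemann, Commun. Math. Phys. **110** (1987) 261–286, Sect. 2 p.264 (2.6)–(2.12),
Sect. 3 p.266 (A₁), Theorem 2 part 1) p.280 with its proof line p.281 L.27. Read by this seat on its own 3× page renders
of the journal scan (`renders-cmp110ms/`, p.264 = PDF 4, pp.280–281 = PDF 20–21). Lean lane of the lit-balaban YM LIT
SWEEP CONTEXT row X1 (register `MullerSchiemann1987/`); the model is the `d = 4` HIERARCHICAL `SU(2)` gauge model (Migdal's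
recursion), NOT lattice Yang–Mills. Siblings: `MS87HeatKernelGroup` proves (2.8)–(2.12) for the heat-kernel factor `g̃_HK`
itself and defines `diagPhase x = e^{−ixσ₃}`; `MS87ClassFunctionsSU2` has the REAL-angle evenness / periodicity of
`θ ↦ g(e^{−iθσ₃})` for class functions; `MS87Theorem3CommonSubsequence` takes `2π`-periodicity of the `h_N^{(−n)}` on `ℂ`
as a hypothesis (`Function.Periodic F (2π)`). THIS FILE gives the model-free complex statements from (2.8)–(2.9), i.e.
Theorem 2 part 1) at every scale at the level «1) restates (A₁)».

**What the paper prints.** p.264: *«the additional symmetry properties hold z ∈ ℂ, x′ ∈ ℝ,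
g̃⁽ⁿ⁾(e^{−ix′σ₃}u, z) = g̃⁽ⁿ⁾(u, x′ + z), (2.8)  g̃⁽ⁿ⁾(u, z) = g̃⁽ⁿ⁾(u⁻¹, −z). (2.9) … In particular the functions
h⁽ⁿ⁾(z) := g̃⁽ⁿ⁾(e₀, z) (2.10) are entire holomorphic in z ∈ ℂ, periodic with period 2π and even functions due to (2.9),
h⁽ⁿ⁾(z + π) = h⁽ⁿ⁾(z − π), (2.11)  h⁽ⁿ⁾(z) = h⁽ⁿ⁾(−z). (2.12)»* p.266 (A₁): *«g̃(u, z) is continuous in u ∈ G for fixed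
z ∈ ℂ and entire holomorphic in z for fixed u. Moreover g(u) = g̃(u, 0) is real and positive, satisfying (2.1)–(2.3).»*
p.280 Theorem 2: *«1) The inductively defined functions h_N^{(−n)}(z), n ∈ ℕ₀ with n ≦ N, which are the Gibbs factors on
scale n, expressed as a function of (and analytically continued in) the central angle, are entire holomorphic in
z ∈ ℂ, 2π-periodic and real positive for z ∈ ℝ.»*; p.281 L.27: *«1) restates (A₁) and has already been commented on in
Sect. 2.»*

**What this file proves (kernel-checked, 0 sorry, standard axioms; theorems only, no definition, no named fact).** For any
`g̃ : SU(2) → ℂ → ℂ` (a letter) and `h(z) := g̃(e₀, z)`: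
* `e^{−i·2π·σ₃} = e₀` (`diagPhase_two_pi`), `e^{−i(x+2π)σ₃} = e^{−ixσ₃}` (`diagPhase_add_two_pi`);
* **(2.11)** from (2.8): `h(z + 2π) = h(z)` for all `z ∈ ℂ` (`h_periodic`, as `Function.Periodic`), and the printed form
  `h(z + π) = h(z − π)` (`eq211`);
* **(2.12)** from (2.9): `h(−z) = h(z)` (`h_even`);
* **THEOREM 2 PART 1), MODEL-FREE** (`thm2_part1`): under (A₁) — `g̃(e₀, ·)` entire, (2.8), and `g(u) = g̃(u, 0)` real
  and positive — `h` is entire, `2π`-periodic, and real positive on `ℝ` (`h(x) = g(e^{−ixσ₃})` by (2.8), `h_ofReal`).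

**Readings / scope (declared).** (i) «restates (A₁)»: the induction hypotheses (A₁), (2.8), (2.9) at the given scale are
the hypotheses; that they hold at every scale `n ≤ N` is Theorem 1 iterated (not formalised). (ii) «real positive for
z ∈ ℝ» is rendered as `h(x) = (g(e^{−ixσ₃}) : ℂ)` with `g(e^{−ixσ₃}) > 0` for the real Gibbs factor `g`.

**Not claimed.** Theorem 1, Theorem 2 parts 2)–4) (siblings), anything about lattice Yang–Mills or the Clay problem.
-/

namespace Literature.MathematicalPhysics.QuantumFieldTheory

namespace MullerSchiemann1987

namespace Theorem2Part1

open HeatKernel (diagPhase coe_diagPhase diagPhase_zero diagPhase_add)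

/-- `e^{−i·2π·σ₃} = e₀` (`e^{∓2πi} = 1`). [cite: MullerSchiemann1987, (2.6), (2.11) p.264] -/
theorem diagPhase_two_pi : diagPhase (2 * Real.pi) = 1 := by
  apply Subtype.ext
  rw [coe_diagPhase, OneMemClass.coe_one]
  have h1 : Complex.exp (((-(2 * Real.pi) : ℝ) : ℂ) * Complex.I) = 1 := by
    rw [show (((-(2 * Real.pi) : ℝ) : ℂ) * Complex.I) = -(2 * Real.pi * Complex.I) by push_cast; ring,
      Complex.exp_neg, Complex.exp_two_pi_mul_I, inv_one]
  have h2 : Complex.exp (((2 * Real.pi : ℝ) : ℂ) * Complex.I) = 1 := by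
    rw [show (((2 * Real.pi : ℝ) : ℂ) * Complex.I) = 2 * Real.pi * Complex.I by push_cast; ring,
      Complex.exp_two_pi_mul_I]
  rw [h1, h2]
  ext i j
  fin_cases i <;> fin_cases j <;> simp

/-- `e^{−i(x + 2π)σ₃} = e^{−ixσ₃}`. [cite: MullerSchiemann1987, (2.6), (2.11) p.264] -/
theorem diagPhase_add_two_pi (x : ℝ) : diagPhase (x + 2 * Real.pi) = diagPhase x := by
  rw [diagPhase_add, diagPhase_two_pi, mul_one]

/-- **(2.11) FROM (2.8): `h(z) := g̃(e₀, z)` is `2π`-periodic on `ℂ`** — `g̃(e₀, z + 2π) = g̃(e^{−i2πσ₃}, z) = g̃(e₀, z)`.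
[cite: MullerSchiemann1987, (2.8), (2.10)–(2.11) p.264] -/
theorem h_periodic {gt : Matrix.specialUnitaryGroup (Fin 2) ℂ → ℂ → ℂ}
    (h28 : ∀ (x : ℝ) (U : Matrix.specialUnitaryGroup (Fin 2) ℂ) (z : ℂ), gt (diagPhase x * U) z = gt U ((x : ℂ) + z)) :
    Function.Periodic (fun z => gt 1 z) (2 * (Real.pi : ℂ)) := by
  intro z
  show gt 1 (z + 2 * Real.pi) = gt 1 z
  have h := h28 (2 * Real.pi) 1 z
  rw [diagPhase_two_pi, mul_one] at h
  rw [show z + 2 * (Real.pi : ℂ) = ((2 * Real.pi : ℝ) : ℂ) + z by push_cast; ring, ← h]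

/-- **(2.11) as printed: `h(z + π) = h(z − π)`**. [cite: MullerSchiemann1987, (2.11) p.264] -/
theorem eq211 {gt : Matrix.specialUnitaryGroup (Fin 2) ℂ → ℂ → ℂ}
    (h28 : ∀ (x : ℝ) (U : Matrix.specialUnitaryGroup (Fin 2) ℂ) (z : ℂ), gt (diagPhase x * U) z = gt U ((x : ℂ) + z))
    (z : ℂ) : gt 1 (z + Real.pi) = gt 1 (z - Real.pi) := by
  have h := h_periodic h28 (z - Real.pi)
  rw [show z - (Real.pi : ℂ) + 2 * Real.pi = z + Real.pi by ring] at h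
  exact h

/-- **(2.12) FROM (2.9): `h` is even**, `h(−z) = g̃(e₀, −z) = g̃(e₀⁻¹, z) = h(z)`.
[cite: MullerSchiemann1987, (2.9), (2.12) p.264] -/
theorem h_even {gt : Matrix.specialUnitaryGroup (Fin 2) ℂ → ℂ → ℂ}
    (h29 : ∀ (U : Matrix.specialUnitaryGroup (Fin 2) ℂ) (z : ℂ), gt U z = gt U⁻¹ (-z)) (z : ℂ) :
    gt 1 (-z) = gt 1 z := by
  rw [h29 1 (-z), inv_one, neg_neg]

/-- **`h` on the real axis is the real Gibbs factor along the one-parameter subgroup**: `h(x) = g̃(e^{−ixσ₃}, 0) = g(e^{−ixσ₃})`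
((2.8) with `z = 0`; (2.10)/(2.16)). [cite: MullerSchiemann1987, (2.8), (2.10) p.264, (2.16) p.265] -/
theorem h_ofReal {gt : Matrix.specialUnitaryGroup (Fin 2) ℂ → ℂ → ℂ}
    (h28 : ∀ (x : ℝ) (U : Matrix.specialUnitaryGroup (Fin 2) ℂ) (z : ℂ), gt (diagPhase x * U) z = gt U ((x : ℂ) + z))
    (x : ℝ) : gt 1 (x : ℂ) = gt (diagPhase x) 0 := by
  rw [← mul_one (diagPhase x), h28, add_zero]

/-- **THEOREM 2 PART 1), MODEL-FREE («1) restates (A₁)»)**: if `g̃` satisfies (A₁) at the given scale — `g̃(e₀, ·)`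
entire, the symmetry (2.8), and `g(u) = g̃(u, 0)` real and positive (`g̃(u, 0) = g(u)` with `g(u) > 0`) — then
`h(z) = g̃(e₀, z)` is entire holomorphic in `z ∈ ℂ`, `2π`-periodic, and real positive for `z ∈ ℝ` (`h(x) = g(e^{−ixσ₃}) > 0`).
[cite: MullerSchiemann1987, Theorem 2 part 1) p.280, p.281 L.27; (A₁) p.266; (2.8), (2.10)–(2.11) p.264] -/
theorem thm2_part1 {gt : Matrix.specialUnitaryGroup (Fin 2) ℂ → ℂ → ℂ} {g : Matrix.specialUnitaryGroup (Fin 2) ℂ → ℝ}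
    (hA1 : Differentiable ℂ (gt 1))
    (h28 : ∀ (x : ℝ) (U : Matrix.specialUnitaryGroup (Fin 2) ℂ) (z : ℂ), gt (diagPhase x * U) z = gt U ((x : ℂ) + z))
    (hg : ∀ U : Matrix.specialUnitaryGroup (Fin 2) ℂ, gt U 0 = (g U : ℂ))
    (hpos : ∀ U : Matrix.specialUnitaryGroup (Fin 2) ℂ, 0 < g U) :
    Differentiable ℂ (fun z => gt 1 z) ∧ Function.Periodic (fun z => gt 1 z) (2 * (Real.pi : ℂ)) ∧
      ∀ x : ℝ, gt 1 (x : ℂ) = (g (diagPhase x) : ℂ) ∧ 0 < g (diagPhase x) :=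
  ⟨hA1, h_periodic h28, fun x => ⟨by rw [h_ofReal h28, hg], hpos _⟩⟩

end Theorem2Part1

end MullerSchiemann1987

end Literature.MathematicalPhysics.QuantumFieldTheory
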